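import Mathlib
import Literature.Computability.AlgebraicComplexity.NewtonPolygonTauProductBounds
import Summits.ValiantsHypothesis.ValiantsHypothesis.Theorems.NewtonUnitEquationsDissociatedUniformTotalsLawStaircase
import HarnessLib

/-!
# Crux `NewtonUnitEquations.DissociatedUniform` (stmt-ValiantsHypothesis-5905): the `n = 3` totals law — DOMINANCE SUMS
# (the two-dimensional staircase: `#vert conv {v i + b j : ρ₁ i < γ₁ j ∧ ρ₂ i < γ₂ j} ≤ 4K(#R + #C)` for positions `< 2^K`)

Memo `Cruxes/DissociatedUniform/NOTES-t1g17.md` §4.  The STAIRCASE HULL BOUND of `…TotalsLawStaircase`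
(`Stair.ncard_extremePoints_stairPts_le`: the half-graph restricted sum `{v i + b j : ρ i < γ j}` has `≤ 4(#R + #C)` hull vertices)
drives the interval stratum (`…IntervalUnionLinear`, windows reduce to staircases).  Memo `NOTES-t1g16.md` §6(v) names the NEXT
stratum — BOXES `Z = I₁ × I₂` (rank-two Bohr sets) — and its obstruction: the block reduction then produces TWO-DIMENSIONAL staircases
`{v i + b j : ρ₁ i < γ₁ j ∧ ρ₂ i < γ₂ j}` (a dominance relation), for which the record-pattern separation of the staircase sweep
fails.  This file bounds dominance sums anyway, up to a logarithm, by a SEGMENT-TREE DECOMPOSITION of the first coordinate: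
* `Stair.exists_dyadic_split` — if `ρ < γ < 2^K` there is a level `1 ≤ ℓ ≤ K` and a block index `t` with
  `ρ / 2^{ℓ-1} = 2t` and `γ / 2^{ℓ-1} = 2t + 1` (the two positions part at the children of their lowest common dyadic ancestor);
* `Stair.domPts_eq_biUnion` — hence the dominance sum is the union over the `≤ K·2^K` nodes `(ℓ, t)` of the ONE-dimensional
  staircases (second coordinate only) between the rows with `ρ₁ / 2^{ℓ-1} = 2t` and the columns with `γ₁ / 2^{ℓ-1} = 2t + 1`
  (every such pair satisfies the first relation automatically);
* at each level the node row-sets (and column-sets) are pairwise disjoint, so `Σ_nodes (#rows + #cols) ≤ K(#R + #C)`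
  (`Stair.sum_card_filter_div_le`), and the union bound `KPTT…ncard_extremePoints_biUnion_le` with the staircase bound per node give
  **`Stair.ncard_extremePoints_domPts_le : #vert conv(domPts) ≤ 4K(#R + #C)`** (no injectivity and no bound needed for
  `ρ₁`, only `γ₁ < 2^K`; `ρ₂, γ₂` injective as in the staircase theorem) and `Stair.ncard_extremePoints_domPts_le_size` (`K = Nat.size M` for positions `< M`,
  i.e. `O((#R + #C) log M)`).
What is NOT here: the 2D block reduction of box-unions `U_s(I₁ × I₂)` to dominance sums (the analogue of `…IntervalUnionLinear` §2), and
whether the logarithm is necessary (for ONE-dimensional staircases it is not).  Honest label: a planar incidence tool; `UnionTotalsLaw C`,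
`TotalsLawThree C` remain OPEN and are asserted nowhere; nothing here bears on VP ≠ VNP.
[folklore: range-tree decomposition of a dominance relation into products]
-/

set_option linter.dupNamespace false -- `ValiantsHypothesis.ValiantsHypothesis` (summit = problem) in every name

open Matrix Finset
open scoped BigOperators Pointwise

namespace Summit.ValiantsHypothesis.ValiantsHypothesis.Theorems.NewtonUnitEquationsDissociatedUniform

namespace TotalsLaw

namespace Stair

open Literature.Computability.AlgebraicComplexity.KPTT.PlanarMinkowski

variable {ι κ : Type*}

/-! ### The dyadic split of a pair of positions -/

/-- **Lowest common dyadic ancestor.**  If `ρ < γ < 2^K` then for some level `1 ≤ ℓ ≤ K` and block index `t`,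
`ρ / 2^{ℓ-1} = 2t` and `γ / 2^{ℓ-1} = 2t + 1`. [folklore] -/
theorem exists_dyadic_split : ∀ (K ρ γ : ℕ), ρ < γ → γ < 2 ^ K →
    ∃ ℓ t : ℕ, 1 ≤ ℓ ∧ ℓ ≤ K ∧ ρ / 2 ^ (ℓ - 1) = 2 * t ∧ γ / 2 ^ (ℓ - 1) = 2 * t + 1 := by
  intro K
  induction K with
  | zero => intro ρ γ h1 h2; simp at h2; omega
  | succ K ih =>
    intro ρ γ hργ hγ
    by_cases hγK : γ < 2 ^ K
    · obtain ⟨ℓ, t, h1, h2, h3, h4⟩ := ih ρ γ hργ hγK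
      exact ⟨ℓ, t, h1, h2.trans (Nat.le_succ K), h3, h4⟩
    · push Not at hγK
      by_cases hρK : ρ < 2 ^ K
      · -- split at the top level
        refine ⟨K + 1, 0, by omega, le_rfl, ?_, ?_⟩
        · simp only [Nat.add_sub_cancel, mul_zero]
          exact Nat.div_eq_of_lt hρK
        · simp only [Nat.add_sub_cancel, mul_zero, zero_add]
          rw [pow_succ] at hγ
          exact Nat.div_eq_of_lt_le (by simpa using hγK) (by simpa [Nat.mul_comm] using hγ)
      · push Not at hρK
        have hγ' : γ - 2 ^ K < 2 ^ K := by rw [pow_succ] at hγ; omega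
        obtain ⟨ℓ, t, h1, h2, h3, h4⟩ := ih (ρ - 2 ^ K) (γ - 2 ^ K) (by omega) hγ'
        have hpow : 2 ^ K = 2 ^ (ℓ - 1) * 2 ^ (K - (ℓ - 1)) := by
          rw [← pow_add]; congr 1; omega
        have hpos : 0 < 2 ^ (ℓ - 1) := Nat.pos_of_ne_zero (by positivity)
        have e2 : (2 : ℕ) ^ (K - (ℓ - 1)) = 2 * 2 ^ (K - ℓ) := by
          rw [← pow_succ']; congr 1; omega
        refine ⟨ℓ, t + 2 ^ (K - ℓ), h1, h2.trans (Nat.le_succ K), ?_, ?_⟩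
        · have : ρ = (ρ - 2 ^ K) + 2 ^ (K - (ℓ - 1)) * 2 ^ (ℓ - 1) := by rw [Nat.mul_comm, ← hpow]; omega
          rw [this, Nat.add_mul_div_right _ _ hpos, h3, e2]; ring
        · have : γ = (γ - 2 ^ K) + 2 ^ (K - (ℓ - 1)) * 2 ^ (ℓ - 1) := by rw [Nat.mul_comm, ← hpow]; omega
          rw [this, Nat.add_mul_div_right _ _ hpos, h4, e2]; ring

/-- Conversely, positions in the two children of a dyadic node are ordered: `ρ / 2^{ℓ-1} = 2t`, `γ / 2^{ℓ-1} = 2t+1` force `ρ < γ`.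
[folklore] -/
theorem lt_of_dyadic_split {ℓ t ρ γ : ℕ} (hρ : ρ / 2 ^ (ℓ - 1) = 2 * t) (hγ : γ / 2 ^ (ℓ - 1) = 2 * t + 1) : ρ < γ := by
  by_contra h
  push Not at h
  have := Nat.div_le_div_right (c := 2 ^ (ℓ - 1)) h
  omega

/-! ### Dominance sums and their decomposition -/

section Geometry

variable {R : Finset ι} {C : Finset κ} {ρ₁ ρ₂ : ι → ℕ} {γ₁ γ₂ : κ → ℕ} {v : ι → (Fin 2 → ℝ)} {b : κ → (Fin 2 → ℝ)}

/-- The DOMINANCE (two-dimensional staircase) restricted sum `{v i + b j : i ∈ R, j ∈ C, ρ₁ i < γ₁ j, ρ₂ i < γ₂ j}`. -/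
noncomputable def domPts (R : Finset ι) (C : Finset κ) (ρ₁ ρ₂ : ι → ℕ) (γ₁ γ₂ : κ → ℕ) (v : ι → (Fin 2 → ℝ))
    (b : κ → (Fin 2 → ℝ)) : Finset (Fin 2 → ℝ) :=
  ((R ×ˢ C).filter fun p => ρ₁ p.1 < γ₁ p.2 ∧ ρ₂ p.1 < γ₂ p.2).image fun p => v p.1 + b p.2

/-- Membership in `domPts`. [folklore] -/
theorem mem_domPts {x : Fin 2 → ℝ} :
    x ∈ domPts R C ρ₁ ρ₂ γ₁ γ₂ v b ↔ ∃ i ∈ R, ∃ j ∈ C, ρ₁ i < γ₁ j ∧ ρ₂ i < γ₂ j ∧ v i + b j = x := by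
  classical
  simp only [domPts, Finset.mem_image, Finset.mem_filter, Finset.mem_product, Prod.exists]
  constructor
  · rintro ⟨i, j, ⟨⟨hi, hj⟩, h1, h2⟩, h⟩; exact ⟨i, hi, j, hj, h1, h2, h⟩
  · rintro ⟨i, hi, j, hj, h1, h2, h⟩; exact ⟨i, j, ⟨⟨hi, hj⟩, h1, h2⟩, h⟩

/-- The rows of the node `(ℓ, t)`: first position in the LEFT child `[2t·2^{ℓ-1}, (2t+1)·2^{ℓ-1})`. -/
noncomputable def nodeRows (R : Finset ι) (ρ₁ : ι → ℕ) (n : ℕ × ℕ) : Finset ι :=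
  R.filter fun i => ρ₁ i / 2 ^ (n.1 - 1) = 2 * n.2

/-- The columns of the node `(ℓ, t)`: first position in the RIGHT child `[(2t+1)·2^{ℓ-1}, (2t+2)·2^{ℓ-1})`. -/
noncomputable def nodeCols (C : Finset κ) (γ₁ : κ → ℕ) (n : ℕ × ℕ) : Finset κ :=
  C.filter fun j => γ₁ j / 2 ^ (n.1 - 1) = 2 * n.2 + 1

/-- **Segment-tree decomposition.**  With first column positions `< 2^K`, the dominance sum is the union over the nodes
`(ℓ, t) ∈ [1, K] × [0, 2^K)` of the one-dimensional staircases (second coordinate) between the node's rows and columns. [folklore] -/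
theorem domPts_eq_biUnion [DecidableEq (Fin 2 → ℝ)] (K : ℕ) (hC : ∀ j ∈ C, γ₁ j < 2 ^ K) :
    domPts R C ρ₁ ρ₂ γ₁ γ₂ v b =
      (Finset.Icc 1 K ×ˢ Finset.range (2 ^ K)).biUnion fun n =>
        stairPts (nodeRows R ρ₁ n) (nodeCols C γ₁ n) ρ₂ γ₂ v b := by
  classical
  ext x
  rw [mem_domPts, Finset.mem_biUnion]
  constructor
  · rintro ⟨i, hi, j, hj, h1, h2, rfl⟩
    obtain ⟨ℓ, t, hℓ1, hℓK, hρ, hγ⟩ := exists_dyadic_split K (ρ₁ i) (γ₁ j) h1 (hC j hj)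
    have ht : t < 2 ^ K := by
      have h3 : γ₁ j / 2 ^ (ℓ - 1) ≤ γ₁ j := Nat.div_le_self _ _
      have := hC j hj
      omega
    refine ⟨(ℓ, t), Finset.mem_product.2 ⟨Finset.mem_Icc.2 ⟨hℓ1, hℓK⟩, Finset.mem_range.2 ht⟩, ?_⟩
    exact mem_stairPts.2 ⟨i, Finset.mem_filter.2 ⟨hi, hρ⟩, j, Finset.mem_filter.2 ⟨hj, hγ⟩, h2, rfl⟩
  · rintro ⟨n, -, hx⟩
    obtain ⟨i, hi, j, hj, h2, rfl⟩ := mem_stairPts.1 hx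
    obtain ⟨hiR, hρ⟩ := Finset.mem_filter.1 hi
    obtain ⟨hjC, hγ⟩ := Finset.mem_filter.1 hj
    exact ⟨i, hiR, j, hjC, lt_of_dyadic_split hρ hγ, h2, rfl⟩

/-- At a fixed level the node row-sets are pairwise disjoint: `Σ_t #rows(ℓ, t) ≤ #R` (and likewise for columns): generic form for a
filter by the value of a function. [folklore] -/
theorem sum_card_filter_eq_le {α : Type*} [DecidableEq α] (S : Finset α) (f : α → ℕ) (g : ℕ → ℕ) (hg : Function.Injective g)
    (T : Finset ℕ) : ∑ t ∈ T, (S.filter fun a => f a = g t).card ≤ S.card := by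
  classical
  have hdisj : (T : Set ℕ).PairwiseDisjoint fun t => S.filter fun a => f a = g t := by
    intro t _ t' _ hne
    rw [Function.onFun, Finset.disjoint_left]
    intro a ha ha'
    have e1 := (Finset.mem_filter.1 ha).2
    have e2 := (Finset.mem_filter.1 ha').2
    exact hne (hg (e1.symm.trans e2))
  rw [← Finset.card_biUnion hdisj]
  exact Finset.card_le_card (Finset.biUnion_subset.2 fun t _ => Finset.filter_subset _ _)

/-- **THE DOMINANCE HULL BOUND.**  For rows `i ∈ R` and columns `j ∈ C` with first positions `ρ₁, γ₁ < 2^K` (not necessarily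
injective; only the column bound is used) and injective second positions `ρ₂, γ₂`, the dominance sum `{v i + b j : ρ₁ i < γ₁ j ∧ ρ₂ i < γ₂ j}` has at most
`4K(#R + #C)` hull vertices (first positions of columns `< 2^K`). [folklore] -/
theorem ncard_extremePoints_domPts_le (hρ₂ : Function.Injective ρ₂) (hγ₂ : Function.Injective γ₂) (K : ℕ)
    (hC : ∀ j ∈ C, γ₁ j < 2 ^ K) :
    ((convexHull ℝ (domPts R C ρ₁ ρ₂ γ₁ γ₂ v b : Set (Fin 2 → ℝ))).extremePoints ℝ).ncard ≤ 4 * K * (R.card + C.card) := by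
  classical
  set N := Finset.Icc 1 K ×ˢ Finset.range (2 ^ K) with hN
  rw [domPts_eq_biUnion K hC]
  refine (ncard_extremePoints_biUnion_le N _).trans ?_
  calc ∑ n ∈ N, ((convexHull ℝ (stairPts (nodeRows R ρ₁ n) (nodeCols C γ₁ n) ρ₂ γ₂ v b : Set (Fin 2 → ℝ))).extremePoints ℝ).ncard
      ≤ ∑ n ∈ N, 4 * ((nodeRows R ρ₁ n).card + (nodeCols C γ₁ n).card) :=
        Finset.sum_le_sum fun n _ => ncard_extremePoints_stairPts_le hρ₂ hγ₂
    _ = 4 * (∑ ℓ ∈ Finset.Icc 1 K, (∑ t ∈ Finset.range (2 ^ K), (nodeRows R ρ₁ (ℓ, t)).card +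
          ∑ t ∈ Finset.range (2 ^ K), (nodeCols C γ₁ (ℓ, t)).card)) := by
        rw [← Finset.mul_sum, hN, Finset.sum_product]
        congr 1
        refine Finset.sum_congr rfl fun ℓ _ => ?_
        rw [Finset.sum_add_distrib]
    _ ≤ 4 * (∑ _ℓ ∈ Finset.Icc 1 K, (R.card + C.card)) := by
        gcongr with ℓ hℓ
        · exact sum_card_filter_eq_le R (fun i => ρ₁ i / 2 ^ (ℓ - 1)) (fun t => 2 * t)
            (fun t t' (h : 2 * t = 2 * t') => by omega) _
        · exact sum_card_filter_eq_le C (fun j => γ₁ j / 2 ^ (ℓ - 1)) (fun t => 2 * t + 1)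
            (fun t t' (h : 2 * t + 1 = 2 * t' + 1) => by omega) _
    _ = 4 * K * (R.card + C.card) := by
        rw [Finset.sum_const, Nat.card_Icc, smul_eq_mul, Nat.add_sub_cancel]; ring

/-- **Dominance sums with first column positions `< M` have `≤ 4·size(M)·(#R + #C) = O((#R + #C) log M)` hull vertices.** [folklore] -/
theorem ncard_extremePoints_domPts_le_size (hρ₂ : Function.Injective ρ₂) (hγ₂ : Function.Injective γ₂) (M : ℕ)
    (hC : ∀ j ∈ C, γ₁ j < M) :
    ((convexHull ℝ (domPts R C ρ₁ ρ₂ γ₁ γ₂ v b : Set (Fin 2 → ℝ))).extremePoints ℝ).ncard ≤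
      4 * Nat.size M * (R.card + C.card) :=
  ncard_extremePoints_domPts_le hρ₂ hγ₂ (Nat.size M) fun j hj => (hC j hj).trans (Nat.lt_size_self M)

end Geometry

end Stair

end TotalsLaw

end Summit.ValiantsHypothesis.ValiantsHypothesis.Theorems.NewtonUnitEquationsDissociatedUniform
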